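import Summits.Ventures.HodgeRepro.GSetHodge
import Summits.Ventures.HodgeRepro.FaceReduce

/-!
# Hodge cocharacters on `ℂ^X` for a finite set `X` of embeddings: the weight of a coordinate wedge, and
Pohlmann's condition for CM algebras (`G`-sets) and for products of CM types

Blind re-derivation cell `pub-hodge-repro`, seat `typer-2` (gen 10).  The index-type-free version of this
seat's `CMHodgeWedge.lean` (gen 9, written on `Hom(K, ℂ)` for a Galois CM field `K`), as suggested by
route-2 (ROUTE-B §9.21(b)(iii): «the same diagonalisation runs verbatim with `Hom(E, F)` in place of
`Gal(K/ℚ)`»).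

Model.  `X` a finite set (the embeddings `Hom(E, ℂ)` of a CM algebra `E`; `X = J × G` for a product of
CM types on one Galois CM field, `FaceReduce.lean`).  A subset `Φ ⊆ X` gives the cocharacter
`μ_Φ(λ)` of the torus `Res_{E/ℚ} 𝔾_m` acting on `ℂ^X = E ⊗ ℂ` by `λ` on the coordinates in `Φ` and by
`1` on the others (`cocharOn Φ λ`, the diagonal operator — Deligne LNM 900 Ex. 3.7 as printed, the Hodge
cocharacter of the Hodge structure of CM type `Φ`).  Its `n`-th exterior power acts on the coordinate wedge
`e_S = e_{s 0} ∧ ⋯ ∧ e_{s (n−1)}` by `λ^{|S ∩ Φ|}` (`map_cocharOn_coordWedgeOn`); for injective `s`,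
`e_S` is of type `(p, n − p)` for `μ_Φ` iff `|S ∩ Φ| = p` (`forall_map_cocharOn_coordWedgeOn_eq_iff`).

Dictionaries (the `(p, p)`-condition for every conjugate cocharacter ⟺ Pohlmann's combinatorial
condition):
* `G`-sets / CM algebras (`GSetHodge.lean`): `isHodgeSetOn_iff_forall_map_cocharOn_smul_eq` —
  `IsHodgeSetOn c Φ S ↔ ∀ g λ, ⋀^{2p} μ_{g • Φ}(λ) e_S = λ^p e_S`;
* products of CM types of one Galois CM field (`FaceReduce.lean`): the product type set
  `prodTypeSet Φ = {(j, x) : x ∈ Φ j} ⊆ J × G` has cocharacter `μ_{Φ}(λ)` acting on `ℂ^{J × G}`, and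
  `isHodgeSetProd_iff_forall_map_cocharOn_eq` — `IsHodgeSetProd c Φ S ↔ ∀ g λ, ⋀^{2p} μ_{g • Φ}(λ) e_S = λ^p e_S`
  (so typer's `IsHodgeSetProd` IS the `(p, p)`-condition of the product variety `∏_j A_{Φ j}`).

The span form (joint eigenspace = span of Pohlmann's wedges) is `CMHodgeSpanOn.lean`.
-/

open Finset Module
open scoped Pointwise

namespace HodgeRepro.CMHodgeOn

section Wedge

variable {X : Type*} [DecidableEq X]

/-- The cocharacter of a subset `Φ ⊆ X` at `λ ∈ ℂ`: the diagonal operator on `ℂ^X` multiplying the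
coordinates in `Φ` by `λ` and fixing the others. -/
def cocharOn (Φ : Finset X) (lam : ℂ) : (X → ℂ) →ₗ[ℂ] (X → ℂ) where
  toFun v := fun x => (if x ∈ Φ then lam else 1) * v x
  map_add' v w := by
    funext x
    simp only [Pi.add_apply, mul_add]
  map_smul' r v := by
    funext x
    simp only [Pi.smul_apply, smul_eq_mul, RingHom.id_apply]
    ring

/-- The cocharacter, pointwise. -/
@[simp] theorem cocharOn_apply (Φ : Finset X) (lam : ℂ) (v : X → ℂ) (x : X) :
    cocharOn Φ lam v x = (if x ∈ Φ then lam else 1) * v x := rfl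

/-- The coordinate vector `e_x ∈ ℂ^X`. -/
def coordVecOn (x : X) : X → ℂ := Pi.single x 1

/-- `e_x y = 1` if `y = x`, `0` otherwise. -/
theorem coordVecOn_apply (x y : X) : coordVecOn x y = if y = x then 1 else 0 := by
  simp [coordVecOn, Pi.single_apply]

/-- The cocharacter acts on a coordinate vector by `λ` or `1` according to whether `x ∈ Φ`. -/
theorem cocharOn_coordVecOn (Φ : Finset X) (lam : ℂ) (x : X) :
    cocharOn Φ lam (coordVecOn x) = (if x ∈ Φ then lam else 1) • coordVecOn x := by
  funext y
  simp only [cocharOn_apply, coordVecOn_apply, Pi.smul_apply, smul_eq_mul]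
  by_cases hyx : y = x
  · subst hyx
    simp
  · simp [hyx]

/-- The coordinate wedge `e_{s 0} ∧ ⋯ ∧ e_{s (n−1)} ∈ ⋀[ℂ]^n ℂ^X` of a family `s : Fin n → X`. -/
noncomputable def coordWedgeOn (n : ℕ) (s : Fin n → X) : ⋀[ℂ]^n (X → ℂ) :=
  exteriorPower.ιMulti ℂ n fun i => coordVecOn (s i)

/-- The number of corners of `s` lying in `Φ`: `|{i : s i ∈ Φ}|`. -/
def cornerCountOn (Φ : Finset X) {n : ℕ} (s : Fin n → X) : ℕ := (univ.filter fun i => s i ∈ Φ).card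

/-- For an injective enumeration `s` of `S = range s`, `cornerCountOn Φ s = |S ∩ Φ|`. -/
theorem cornerCountOn_eq_card_inter (Φ : Finset X) {n : ℕ} {s : Fin n → X}
    (hs : Function.Injective s) : cornerCountOn Φ s = (univ.image s ∩ Φ).card := by
  unfold cornerCountOn
  rw [← Finset.filter_mem_eq_inter, Finset.filter_image, Finset.card_image_of_injective _ hs]

/-- **The weight of a coordinate wedge**: `⋀^n μ_Φ(λ)` multiplies `e_{s 0} ∧ ⋯ ∧ e_{s (n−1)}` by
`λ^{|{i : s i ∈ Φ}|}`. -/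
theorem map_cocharOn_coordWedgeOn (Φ : Finset X) (lam : ℂ) {n : ℕ} (s : Fin n → X) :
    exteriorPower.map n (cocharOn Φ lam) (coordWedgeOn n s) =
      lam ^ cornerCountOn Φ s • coordWedgeOn n s := by
  unfold coordWedgeOn cornerCountOn
  rw [exteriorPower.map_apply_ιMulti]
  have h : (cocharOn Φ lam ∘ fun i => coordVecOn (s i)) =
      fun i => (if s i ∈ Φ then lam else 1) • coordVecOn (s i) := by
    funext i
    exact cocharOn_coordVecOn Φ lam (s i)
  have h2 := AlternatingMap.map_smul_univ (exteriorPower.ιMulti ℂ n)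
    (fun i => if s i ∈ Φ then lam else 1) (fun i => coordVecOn (s i))
  rw [h, h2, Finset.prod_ite, Finset.prod_const_one, mul_one, Finset.prod_const]

/-- The pairing of the wedge of the coordinate projections with the coordinate wedge of an injective `s`
is `1`. -/
theorem pairingDual_proj_coordWedgeOn {n : ℕ} {s : Fin n → X} (hs : Function.Injective s) :
    exteriorPower.pairingDual ℂ (X → ℂ) n
      (exteriorPower.ιMulti ℂ n fun j => (LinearMap.proj (s j) : (X → ℂ) →ₗ[ℂ] ℂ))
      (coordWedgeOn n s) = 1 := by
  unfold coordWedgeOn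
  rw [exteriorPower.pairingDual_ιMulti_ιMulti]
  have h : (Matrix.of fun i j : Fin n =>
      (LinearMap.proj (s j) : (X → ℂ) →ₗ[ℂ] ℂ) (coordVecOn (s i))) = (1 : Matrix (Fin n) (Fin n) ℂ) := by
    ext i j
    rw [Matrix.of_apply, LinearMap.proj_apply, coordVecOn_apply, Matrix.one_apply]
    by_cases hij : i = j
    · subst hij
      simp
    · rw [if_neg (fun h => hij (hs h).symm), if_neg hij]
  rw [h, Matrix.det_one]

/-- The coordinate wedge of an injective family is non-zero. -/
theorem coordWedgeOn_ne_zero {n : ℕ} {s : Fin n → X} (hs : Function.Injective s) :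
    coordWedgeOn n s ≠ 0 := by
  intro h
  have := pairingDual_proj_coordWedgeOn hs
  rw [h, map_zero] at this
  exact zero_ne_one this

/-- If every `⋀^n μ_Φ(λ)` multiplies a non-zero `ω` both by `λ^p` and by `λ^q`, then `p = q`. -/
theorem exponent_unique (Φ : Finset X) {n : ℕ} {ω : ⋀[ℂ]^n (X → ℂ)} (hω : ω ≠ 0) {p q : ℕ}
    (hp : ∀ lam : ℂ, exteriorPower.map n (cocharOn Φ lam) ω = lam ^ p • ω)
    (hq : ∀ lam : ℂ, exteriorPower.map n (cocharOn Φ lam) ω = lam ^ q • ω) : p = q := by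
  have h := (hp 2).symm.trans (hq 2)
  have h0 : (2 : ℂ) ^ p = 2 ^ q := smul_left_injective ℂ hω h
  have h' : ((2 ^ p : ℕ) : ℂ) = ((2 ^ q : ℕ) : ℂ) := by push_cast; exact h0
  exact Nat.pow_right_injective (le_refl 2) (Nat.cast_injective h')

/-- **Type of a coordinate wedge**: for injective `s`, `e_S` is of type `(p, n − p)` for `μ_Φ` iff exactly
`p` of its corners lie in `Φ`. -/
theorem forall_map_cocharOn_coordWedgeOn_eq_iff (Φ : Finset X) {n : ℕ} {s : Fin n → X}
    (hs : Function.Injective s) (p : ℕ) :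
    (∀ lam : ℂ, exteriorPower.map n (cocharOn Φ lam) (coordWedgeOn n s) = lam ^ p • coordWedgeOn n s) ↔
      cornerCountOn Φ s = p := by
  constructor
  · intro h
    exact exponent_unique Φ (coordWedgeOn_ne_zero hs) (fun lam => map_cocharOn_coordWedgeOn Φ lam s) h
  · rintro rfl lam
    exact map_cocharOn_coordWedgeOn Φ lam s

/-- The general form of the dictionary: for an injective `s` with `2p` corners and ANY family of subsets
`Ψ γ ⊆ X`, `e_S` is a `(p, p)`-class for every `μ_{Ψ γ}` iff `|S ∩ Ψ γ| = p` for every `γ`. -/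
theorem forall_map_cocharOn_eq_iff_forall_card_inter {Γ : Type*} (Ψ : Γ → Finset X) {n : ℕ}
    {s : Fin n → X} (hs : Function.Injective s) (p : ℕ) :
    (∀ (γ : Γ) (lam : ℂ),
        exteriorPower.map n (cocharOn (Ψ γ) lam) (coordWedgeOn n s) = lam ^ p • coordWedgeOn n s) ↔
      ∀ γ : Γ, (univ.image s ∩ Ψ γ).card = p := by
  refine forall_congr' fun γ => ?_
  rw [forall_map_cocharOn_coordWedgeOn_eq_iff (Ψ γ) hs p, cornerCountOn_eq_card_inter (Ψ γ) hs]

end Wedge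

/-! ### `G`-sets: CM algebras -/

section GSet

variable {G : Type*} [Group G] {X : Type*} [MulAction G X] [Fintype X] [DecidableEq X]

/-- **Pohlmann's condition on a `G`-set = the `(p, p)`-condition for every conjugate cocharacter**: for an
injective family `s` of `2p` embeddings with corner set `S`, `IsHodgeSetOn c Φ S` (GSetHodge.lean) iff
`⋀^{2p} μ_{g • Φ}(λ) e_S = λ^p e_S` for every `g ∈ G` and `λ`. -/
theorem isHodgeSetOn_iff_forall_map_cocharOn_smul_eq {c : G} (hc : IsComplexConj c) {Φ : Finset X}
    (hΦ : IsCMTypeOn c Φ) {p : ℕ} {s : Fin (2 * p) → X} (hs : Function.Injective s) :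
    IsHodgeSetOn c Φ (univ.image s) ↔
      ∀ (g : G) (lam : ℂ), exteriorPower.map (2 * p) (cocharOn (g • Φ) lam) (coordWedgeOn (2 * p) s) =
        lam ^ p • coordWedgeOn (2 * p) s := by
  rw [forall_map_cocharOn_eq_iff_forall_card_inter (fun g : G => g • Φ) hs p,
    isHodgeSetOn_iff_forall_card_eq hc hΦ _ p]
  rw [Finset.card_image_of_injective _ hs, Finset.card_univ, Fintype.card_fin]

end GSet

/-! ### Products of CM types of one Galois CM field -/

section Prod

variable {G : Type*} [Group G] [Fintype G] [DecidableEq G] {J : Type*} [Fintype J] [DecidableEq J]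

/-- The *product type set* of a family `Φ : J → Finset G` of CM types: `{(j, x) : x ∈ Φ j} ⊆ J × G`, the
CM type of the product `∏_j A_{Φ j}` read on `Hom(K^J, ℂ) = J × Hom(K, ℂ)`. -/
def prodTypeSet (Φ : J → Finset G) : Finset (J × G) := univ.filter fun q => q.2 ∈ Φ q.1

omit [Group G] [DecidableEq J] in
/-- Membership in the product type set. -/
@[simp] theorem mem_prodTypeSet (Φ : J → Finset G) (q : J × G) : q ∈ prodTypeSet Φ ↔ q.2 ∈ Φ q.1 := by
  simp [prodTypeSet]

/-- `|S ∩ g • (product type)| = #{q ∈ S : g⁻¹ q.2 ∈ Φ q.1}`: the product type's weight on `S` is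
FaceReduce's filter count at `τ = g⁻¹`. -/
theorem card_inter_prodTypeSet_smul (Φ : J → Finset G) (S : Finset (J × G)) (g : G) :
    (S ∩ prodTypeSet (fun j => g • Φ j)).card = (S.filter fun q => g⁻¹ * q.2 ∈ Φ q.1).card := by
  rw [← Finset.filter_mem_eq_inter]
  refine congrArg Finset.card (Finset.filter_congr fun q _ => ?_)
  rw [mem_prodTypeSet, ← Finset.inv_smul_mem_iff, smul_eq_mul]

/-- **Pohlmann's condition for a product of CM types = the `(p, p)`-condition for every conjugate
cocharacter of the product**: for an injective family `s` of `2p` points of `J × G` with corner set `S`,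
typer's `IsHodgeSetProd c Φ S` (FaceReduce.lean) iff `⋀^{2p} μ_{g • Φ}(λ) e_S = λ^p e_S` for every
`g ∈ G` and `λ`, where `μ_{g • Φ}` is the cocharacter of the product type set of `(g • Φ j)_j`. -/
theorem isHodgeSetProd_iff_forall_map_cocharOn_eq {c : G} (hc : IsComplexConj c) {Φ : J → Finset G}
    (hΦ : ∀ k, IsCMType c (Φ k)) {p : ℕ} {s : Fin (2 * p) → J × G} (hs : Function.Injective s) :
    IsHodgeSetProd c Φ (univ.image s) ↔
      ∀ (g : G) (lam : ℂ),
        exteriorPower.map (2 * p) (cocharOn (prodTypeSet fun j => g • Φ j) lam) (coordWedgeOn (2 * p) s) =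
          lam ^ p • coordWedgeOn (2 * p) s := by
  rw [forall_map_cocharOn_eq_iff_forall_card_inter (fun g : G => prodTypeSet fun j => g • Φ j) hs p,
    isHodgeSetProd_iff_two_mul hc hΦ]
  have hcard : (univ.image s).card = 2 * p := by
    rw [Finset.card_image_of_injective _ hs, Finset.card_univ, Fintype.card_fin]
  constructor
  · intro h g
    rw [card_inter_prodTypeSet_smul]
    have := h g⁻¹
    rw [hcard] at this
    omega
  · intro h τ
    have := h τ⁻¹
    rw [card_inter_prodTypeSet_smul, inv_inv] at this
    rw [this, hcard]

end Prod

end HodgeRepro.CMHodgeOn
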